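import Summits.BirchSwinnertonDyer.Rank1Residual.Supersingular.SignedRankOneCorA5
import HarnessLib

/-!
# UI-X7 — the conjectural UNIFORM statement for pocket X7 (good supersingular `p`, `E/ℚ` NOT
# semistable): Kobayashi's signed main conjecture at NON-square-free level, typed on the census
# class predicate, in its two shapes (`p ≥ 5`, and `p = 3 ∧ a₃ = 0`), with the decidable
# "abelian local type" sub-pocket that the printed Eisenstein-congruence engine is predicted to reach
# (cell `bsd-uniform`, seat `ui-x7`, planner gen 0)

HONEST FRAMING. What this file IS: ONE clearly labelled CONJECTURE (`X7SignedMainConjecture`, a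
`def … : Prop`, nothing asserted, no axiom, no `sorry`), restricting to the census pocket
X7 = `ss(p) ∧ ¬sst` (pub-bsdres `CLASSES.md`: "missing: signed IMC at non-square-free level") the
main conjecture that is IN PRINT AS A CONJECTURE for every `E/ℚ` with `a_p = 0`
[cite: Kobayashi2003, Conjecture (Main Conjecture) (p. 2)] [cite: BurungaleSkinnerTianWan2024, Conj. 1.2]
and is ANNOUNCED only for semistable `E` and for good-ordinary-ramified quadratic twists of semistable
`E` [claim: BurungaleSkinnerTianWan2024, Thm. 1.3, status: under-review]; plus (i) its two SHAPES
`…Ge5` / `…AtThree` and the proof that the conjecture is their conjunction, (ii) the WEAKER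
sub-statement `X7AbelianTameSignedMainConjecture` (also a labelled conjecture, implied by the main one) on the decidable sub-pocket "every additive prime
`ℓ` of `E` is `≥ 5` and of abelian local type" (`v_ℓ(j) < 0`, or `12/gcd(12, v_ℓ(Δ_min)) ∣ ℓ − 1`),
which is where the printed `GU(3,1)` engine is PREDICTED (not proved) to extend — the square-free
hypothesis enters that engine only through local triple-product periods, computed in print for
principal series [cite: Wan2020, Rem. 1.2 (arXiv:1408.4044 p. 4)] [cite: BurungaleSkinnerTianWan2024, proof of Thm. 1.24]
— and (iii) the tree's published consumers, showing that the conjecture is in BSD currency on the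
pocket in BOTH analytic ranks (`r_an = 0`: Wuthrich Prop. 21 chain; `r_an = 1`: Burungale–Kobayashi–Ota
Cor. A.5 chain), granted the named published facts those chains already carry.
What this file is NOT: not a theorem about any curve, not a uniform theorem, not a summit claim;
pocket X7 stays CONSTRUCTION-SHAPED; per-pair certificates elsewhere in the tree are not touched and
do not count as uniform theorems. Proved uniformly in print for this pocket: NOTHING beyond the CM
case [cite: PollackRubin2004 (CM case, as recorded in BurungaleSkinnerTianWan2024 Rem. 1.4 (ii))] and the twist clause above. Residue named in
`run/shared/lean/pub/bsd-uniform/ui/X7-CONJECTURE.md` §3: additive primes of supercuspidal type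
(`e_ℓ ∤ ℓ − 1`, and non-abelian inertia at `2`, `3`) = "local triple product integrals for
supercuspidals" (Wan, loc. cit.), abelian wild types at `2`, `3` (expected as (ii), not typed here),
and curves with no multiplicative prime at which `ρ̄_{E,p}` ramifies (auxiliary-prime hypothesis of
the method, tree `Ram`).

WHY THIS IS NOVEL (one sentence, honest): the conjecture itself is Kobayashi's (2003) restricted to
the pocket — not new; new here are the typed pocket form with both ranks' BSD consumers and the
local-type STRATIFICATION `X7 = abelian-type ⊔ supercuspidal-type` as a pre-registered prediction of
the reach of the printed engine, which we did not find stated in print (BSTW remark only the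
quadratic-twist principal-series case inside a proof).
-/

set_option autoImplicit false

noncomputable section

open scoped Classical MatrixGroups ModularForm

open CongruenceSubgroup WeierstrassCurve Literature.NumberTheory.EllipticCurves
  Literature.NumberTheory.EllipticCurves.ModularForms
  Literature.NumberTheory.EllipticCurves.Rank1Residual
  Literature.NumberTheory.EllipticCurves.Rank1Residual.Typed
  Literature.NumberTheory.EllipticCurves.Kobayashi2003
  Literature.NumberTheory.EllipticCurves.BurungaleKobayashiOta2024
  Summit.BirchSwinnertonDyer.Rank1Residual.Supersingular

namespace Summit.BirchSwinnertonDyer.Uniform.UI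

/-! ### §1 The conjecture (ONE statement) and its two shapes -/

/-- **CONJECTURE UI-X7 (nothing asserted).** For every elliptic curve `E/ℚ` (globally minimal
model `W`), every ODD prime `p` with `(W, p)` in census class X7 — `p` of good supersingular
reduction, `E` not semistable (`ClassX7 W p := GoodSS W p ∧ ¬ Semistable W`) — and `a_p = 0`
(automatic for `p ≥ 5`, a hypothesis at `p = 3`, where the `a₃ = ±3` pairs are the adjacent class
X8), Kobayashi's signed main conjecture holds for BOTH signs: `char_Λ Sel^±(E/ℚ_∞)^∨ = (L_p^±(E))`
(tree: `KobayashiMainConjecture W p ε`, Kobayashi's real objects). In print as a conjecture for every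
`E` with `a_p = 0` and no conductor hypothesis; announced (preprint) for semistable `E` only; for
non-semistable `E` nothing is announced except BSTW's twist clause. This `def` only NAMES the
statement. [cite: Kobayashi2003, Conjecture (Main Conjecture) (p. 2)]
[cite: BurungaleSkinnerTianWan2024, Conj. 1.2 and Thm. 1.3] -/
@[conjecture] def X7SignedMainConjecture : Prop :=
  ∀ (W : WeierstrassCurve ℚ) [W.IsElliptic] [W.IsGloballyMinimal] (p : ℕ) [Fact p.Prime],
    p ≠ 2 → ClassX7 W p → W.frobeniusTrace p = 0 → ∀ ε : ℤˣ, KobayashiMainConjecture W p ε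

/-- **Shape `p ≥ 5`** of UI-X7: on X7 at `p ≥ 5` (`a_p = 0` is automatic by Hasse,
`ClassX7.frobeniusTrace_eq_zero_of_five_le`) the signed main conjecture holds for both signs.
Nothing asserted. [cite: Kobayashi2003, Conjecture (Main Conjecture) (p. 2)] -/
@[conjecture] def X7SignedMainConjectureGe5 : Prop :=
  ∀ (W : WeierstrassCurve ℚ) [W.IsElliptic] [W.IsGloballyMinimal] (p : ℕ) [Fact p.Prime],
    5 ≤ p → ClassX7 W p → ∀ ε : ℤˣ, KobayashiMainConjecture W p ε

/-- **Shape `p = 3`** of UI-X7: on X7 at `p = 3` with `a₃ = 0` (the `a₃ = ±3` good supersingular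
pairs are class X8, `♯/♭` theory, not this statement) the signed main conjecture holds for both
signs. Kobayashi states the conjecture under "Suppose `a_p = 0`", and BSTW's Conj. 1.2 / Thm. 1.3
carry hypothesis (h4) "(only an extra condition when `p = 3`)", read by the tree as `a₃ = 0` — exactly
the hypothesis below. Nothing asserted. [cite: Kobayashi2003, Conjecture (Main Conjecture) (p. 2)]
[cite: BurungaleSkinnerTianWan2024, Conj. 1.2, Thm. 1.3 (hypothesis (h4) at p = 3)] -/
@[conjecture] def X7SignedMainConjectureAtThree : Prop :=
  ∀ (W : WeierstrassCurve ℚ) [W.IsElliptic] [W.IsGloballyMinimal],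
    (haveI : Fact (3 : ℕ).Prime := ⟨Nat.prime_three⟩; ClassX7 W 3) → W.frobeniusTrace 3 = 0 →
    ∀ ε : ℤˣ, (haveI : Fact (3 : ℕ).Prime := ⟨Nat.prime_three⟩; KobayashiMainConjecture W 3 ε)

/-- UI-X7 is exactly the conjunction of its two shapes (an odd prime is `3` or `≥ 5`; at `p ≥ 5`,
`a_p = 0` on X7 is Hasse). [cite: Serre1981, §8.1–8.2 (pp. 188–189)] -/
theorem x7SignedMainConjecture_iff :
    X7SignedMainConjecture ↔ X7SignedMainConjectureGe5 ∧ X7SignedMainConjectureAtThree := by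
  constructor
  · intro h
    refine ⟨fun W _ _ p _ hp5 hX ε ↦ h W p (by omega) hX
      (ClassX7.frobeniusTrace_eq_zero_of_five_le W p hp5 hX) ε, fun W _ _ hX h3 ε ↦ ?_⟩
    haveI : Fact (3 : ℕ).Prime := ⟨Nat.prime_three⟩
    exact h W 3 (by norm_num) hX h3 ε
  · rintro ⟨h5, h3⟩ W _ _ p hpF hp hX hap ε
    by_cases hp5 : 5 ≤ p
    · exact h5 W p hp5 hX ε
    · have hp3 : p = 3 := by
        have := hpF.out.two_le
        interval_cases p
        · exact absurd rfl hp
        · rfl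
        · exact absurd hpF.out (by decide)
      subst hp3
      have h3' := h3 W (by convert hX) (hap) ε
      convert h3'

/-! ### §2 The decidable "abelian local type" sub-pocket (where the printed engine should reach) -/

/-- The tame semistability defect at a prime `ℓ ≥ 5` of potentially good reduction:
`e_ℓ = 12 / gcd(12, v_ℓ(Δ_min))`, the order of the (cyclic) inertia group `Φ_ℓ` of
`ℚ_ℓ^{nr}(E[m])/ℚ_ℓ^{nr}` (Serre–Tate; Kraus). Meaningful only for `ℓ ≥ 5` additive with
`v_ℓ(j) ≥ 0`. [cite: SerreInventiones1972, §5.6 (p. 312)] [cite: SilvermanATAEC1994, IV.9.4, Table 4.1] -/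
def tameDefect (W : WeierstrassCurve ℚ) [W.IsGloballyMinimal] (ℓ : ℕ) : ℕ :=
  12 / Nat.gcd 12 (padicValInt ℓ W.minimalDiscriminantInt)

/-- **Abelian local type at an additive prime `ℓ ≥ 5`** (a `Bool`, decided from `v_ℓ(j)`,
`v_ℓ(Δ_min)`, `ℓ mod 12`): EITHER potentially multiplicative (`v_ℓ(j) < 0`: a ramified quadratic
twist of a Tate curve, local representation a ramified twist of Steinberg) OR potentially good with
`e_ℓ ∣ ℓ − 1` (the inertia character of order `e_ℓ ∈ {2,3,4,6}` factors through `ℤ_ℓ^×`, i.e. `E`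
acquires good reduction over an ABELIAN extension of `ℚ_ℓ` and the local automorphic type is a
ramified PRINCIPAL SERIES); the complement (`e_ℓ ∤ ℓ − 1`) is the SUPERCUSPIDAL type (induced from
the unramified quadratic extension of `ℚ_ℓ`). This is the seat's DEFINITION of the sub-pocket; the
dictionary with automorphic types is the cited classification, not a claim of this file.
[cite: Pacetti2013, Cor. 3.3] [cite: SilvermanATAEC1994, IV.9.4, Table 4.1] -/
def abelianTameTypeAt (W : WeierstrassCurve ℚ) [W.IsElliptic] [W.IsGloballyMinimal] (ℓ : ℕ) : Bool :=
  decide (padicValRat ℓ W.j < 0) || decide (tameDefect W ℓ ∣ ℓ - 1)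

/-- **SUB-STATEMENT UI-X7-ab (a consequence of UI-X7; nothing asserted).** UI-X7 restricted to the
decidable sub-pocket "every additive prime `ℓ` of `W` is `≥ 5` with `abelianTameTypeAt W ℓ`". PRE-REGISTERED PREDICTION (evidence plan,
`ui/X7-CONJECTURE.md` §4): this is the part of X7 that the printed Eisenstein-congruence engine on
`GU(3,1)` reaches without new local theory — "the square-freeness of `N` is put … mainly to avoid
local triple product integrals for supercuspidals" [cite: Wan2020, Rem. 1.2 (arXiv:1408.4044 p. 4)]; for ramified
principal series "the computation of the local period has already appeared in [W1]"
[cite: BurungaleSkinnerTianWan2024, proof of Thm. 1.24] — whereas the complement (a supercuspidal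
additive prime) is the genuine residue. A prediction about proofs, clearly NOT a theorem. -/
@[conjecture] def X7AbelianTameSignedMainConjecture : Prop :=
  ∀ (W : WeierstrassCurve ℚ) [W.IsElliptic] [W.IsGloballyMinimal] (p : ℕ) [Fact p.Prime],
    p ≠ 2 → ClassX7 W p → W.frobeniusTrace p = 0 →
    (∀ ℓ : ℕ, (hℓ : ℓ.Prime) → (haveI : Fact ℓ.Prime := ⟨hℓ⟩; Addv W ℓ) →
      5 ≤ ℓ ∧ abelianTameTypeAt W ℓ = true) →
    ∀ ε : ℤˣ, KobayashiMainConjecture W p ε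

/-- UI-X7 implies its abelian-tame sub-statement (restriction of the quantifier). -/
theorem x7AbelianTame_of_x7SignedMainConjecture (h : X7SignedMainConjecture) :
    X7AbelianTameSignedMainConjecture :=
  fun W _ _ p _ hp hX hap _ ε ↦ h W p hp hX hap ε

/-! ### §3 BSD currency: the conjecture closes the pocket in both analytic ranks, granted the
published facts the tree's chains already name (no new fact, no semistability anywhere) -/

section Consumers

variable (W : WeierstrassCurve ℚ) [W.IsElliptic] [W.IsGloballyMinimal] (p : ℕ) [Fact p.Prime]

/-- **X7 ∩ {r_an = 0}, odd `p`, `a_p = 0`, `ρ̄_{E,p}` surjective: UI-X7 ⇒ `BSD(E,p)`** through the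
tree's Wuthrich-Prop.-21 chain `X7.bsdp_of_kobayashiLowerDivisibility_of_surj_of_analyticRank_eq_zero`
(only the Eisenstein half of ONE sign is consumed). [cite: Wuthrich2014, Prop. 21 (p. 400)]
[cite: Kobayashi2003, Thm. 1.2 and (3.6)] [cite: BDKim2013, Cor. 3.15 (p. 199)] -/
theorem bsdp_of_x7SignedMainConjecture_of_analyticRank_eq_zero (h : X7SignedMainConjecture)
    (hW : Wuthrich2014.sha_dvd_analyticSha)
    (h12 : Kobayashi2003.thm12_signedSelmerDual_finite_torsion)
    (hKim : BDKim2013.cor315_signedCharValue_rankZero)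
    (hPollack : ∀ {N : ℕ} [NeZero N] {f : CuspForm (CongruenceSubgroup.Gamma0 N) 2},
      pollack_exists_plusMinusPAdicLFunction (W := W) (f := f) (p := p))
    (hmod : nonempty_modularParametrizationData) (hmod' : hasEntireLFunction_rat)
    (hGZK : rank_eq_analyticRank_of_analyticRank_le_one)
    (hp : p ≠ 2) (hX : ClassX7 W p) (hap : W.frobeniusTrace p = 0) (hs : Surj W p)
    (h0 : W.analyticRank = 0) : BSDp W p :=
  X7.bsdp_of_kobayashiLowerDivisibility_of_surj_of_analyticRank_eq_zero W p hW h12 hKim hPollack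
    hmod hmod' hGZK hp hX hap hs h0 (kobayashiLowerDivisibility_of_mainConjecture (h W p hp hX hap 1))

/-- **X7 ∩ {r_an = 1}, odd `p`, `a_p = 0`: UI-X7 ⇒ `BSD(E,p)`** through the tree's
Burungale–Kobayashi–Ota Cor. A.5 chain `X7.bsdp_of_kobayashiMainConjecture_of_corA5_of_analyticRank_eq_one`
(no image, level or height hypothesis in that chain). [cite: BurungaleKobayashiOta2023, App. A Cor. A.5]
[cite: Kobayashi2003, Thm. 7.4 (p. 13)] -/
theorem bsdp_of_x7SignedMainConjecture_of_analyticRank_eq_one (h : X7SignedMainConjecture)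
    (hA5 : corA5_pPart_of_signedCharIdeal_eq) (hmod : hasEntireLFunction_rat)
    (hGZK : rank_eq_analyticRank_of_analyticRank_le_one)
    (hp : p ≠ 2) (hX : ClassX7 W p) (hap : W.frobeniusTrace p = 0) (h1 : W.analyticRank = 1) :
    BSDp W p :=
  X7.bsdp_of_kobayashiMainConjecture_of_corA5_of_analyticRank_eq_one W p hA5 hmod hGZK hp hX hap h1 1
    (h W p hp hX hap 1)

/-- The same two consumers for the abelian-tame SUB-statement on its sub-pocket, `r_an = 0`.
[cite: Wuthrich2014, Prop. 21 (p. 400)] [cite: Kobayashi2003, Thm. 1.2 and (3.6)] -/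
theorem bsdp_of_x7AbelianTame_of_analyticRank_eq_zero (h : X7AbelianTameSignedMainConjecture)
    (hW : Wuthrich2014.sha_dvd_analyticSha)
    (h12 : Kobayashi2003.thm12_signedSelmerDual_finite_torsion)
    (hKim : BDKim2013.cor315_signedCharValue_rankZero)
    (hPollack : ∀ {N : ℕ} [NeZero N] {f : CuspForm (CongruenceSubgroup.Gamma0 N) 2},
      pollack_exists_plusMinusPAdicLFunction (W := W) (f := f) (p := p))
    (hmod : nonempty_modularParametrizationData) (hmod' : hasEntireLFunction_rat)
    (hGZK : rank_eq_analyticRank_of_analyticRank_le_one)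
    (hp : p ≠ 2) (hX : ClassX7 W p) (hap : W.frobeniusTrace p = 0) (hs : Surj W p)
    (hab : (∀ ℓ : ℕ, (hℓ : ℓ.Prime) → (haveI : Fact ℓ.Prime := ⟨hℓ⟩; Addv W ℓ) →
      5 ≤ ℓ ∧ abelianTameTypeAt W ℓ = true)) (h0 : W.analyticRank = 0) : BSDp W p :=
  X7.bsdp_of_kobayashiLowerDivisibility_of_surj_of_analyticRank_eq_zero W p hW h12 hKim hPollack
    hmod hmod' hGZK hp hX hap hs h0
    (kobayashiLowerDivisibility_of_mainConjecture (h W p hp hX hap hab 1))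

/-- … and `r_an = 1`. [cite: BurungaleKobayashiOta2023, App. A Cor. A.5] -/
theorem bsdp_of_x7AbelianTame_of_analyticRank_eq_one (h : X7AbelianTameSignedMainConjecture)
    (hA5 : corA5_pPart_of_signedCharIdeal_eq) (hmod : hasEntireLFunction_rat)
    (hGZK : rank_eq_analyticRank_of_analyticRank_le_one)
    (hp : p ≠ 2) (hX : ClassX7 W p) (hap : W.frobeniusTrace p = 0)
    (hab : (∀ ℓ : ℕ, (hℓ : ℓ.Prime) → (haveI : Fact ℓ.Prime := ⟨hℓ⟩; Addv W ℓ) →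
      5 ≤ ℓ ∧ abelianTameTypeAt W ℓ = true)) (h1 : W.analyticRank = 1) : BSDp W p :=
  X7.bsdp_of_kobayashiMainConjecture_of_corA5_of_analyticRank_eq_one W p hA5 hmod hGZK hp hX hap h1 1
    (h W p hp hX hap hab 1)

end Consumers

end Summit.BirchSwinnertonDyer.Uniform.UI

end
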